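import Summits.MatrixMultiplication.MatrixMultiplication.Theses.NonabelianARC
import Summits.MatrixMultiplication.MatrixMultiplication.Theses.AsymptoticRankCW
import Summits.MatrixMultiplication.MatrixMultiplication.Theorems.AsymptoticRankCWBPerm3Form
import Literature.Computability.AlgebraicComplexity.AsymptoticRankBorderRank
import Literature.Barriers.MatrixMultiplication.UniversalMethodBarrierAsymptoticRank

/-!
# Birth skeleton (BC3) for the split piece `Det3Flat` of crux `NAARCLadder`
(route `MatrixMultiplication/NonabelianARC`, parent item `stmt-MatrixMultiplication-4972`;
the piece is the EXISTING shared crux `stmt-MatrixMultiplication-0591`, `Det3Flat` here =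
`BDet3AsymptoticRank` in route AsymptoticRankCW)

`Det3Flat : R̃(ε₃ ⊠ ε₃) = 9` for the route's inline Levi-Civita tensor `ε₃ ∈ ℂ³⊗ℂ³⊗ℂ³`
(`ε₃ ⊠ ε₃ ≅ det₃`, CGLV 2022 Lemma 2.4). Line of attack = the route's declared engine at the
`l = 1` rung, run on `ε₃` and squared at the end (`R̃(t ⊠ t) = R̃(t)²`, PROVED below): the value
`3` is the flattening rank of `ε₃` (lower frame, `stub_lowerFrame`, provable now), and the
constructive content is BORDER-RANK POWER DECAY `bR(ε₃^{⊠N})^{1/N} → 3` (`stub_borderPowerDecay`;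
known data: `bR(ε₃) = 5` PROVED in tree, `bR(ε₃^{⊠2}) = bR(det₃) = 17 < 25`, CGLV 2022 Thm 1.3 /
Conner–Harper–Landsberg 2019, record `R̃(ε₃) ≤ √17 ≈ 4.123`; tools: border apolarity with
Borel-fixed multigraded ideals for `ε₃^{⊠N}` and its `SL₃ × 𝔖_N` symmetry, Buczyńska–Buczyński
2021; the sign-of-life way-point is the route's crux `LeviCivitaBelowFour`, `R̃(ε₃) < 4`, e.g. from
`bR(ε₃^{⊠3}) ≤ 63`). The transfer "border power decay ⇒ `R̃(ε₃) ≤ 3`" is PROVED here.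

Stubs (sorried, registered): `stub_lowerFrame`, `stub_borderPowerDecay`.
The line's target by name, from the named stubs: `Det3Flat_proof` (= `BDet3AsymptoticRank_proof`);
composition with explicit hypotheses (no sorry): `Det3Flat_of`.
-/

set_option linter.dupNamespace false

noncomputable section

open scoped BigOperators
open Filter Literature.Computability.AlgebraicComplexity
open Literature.Barriers.MatrixMultiplication (asymptoticRank_kroneckerPow_le)
open Summit.MatrixMultiplication.MatrixMultiplication.Theorems
  (pow_asymptoticRank_le_asymptoticRank_kroneckerPow asymptoticRank_eq_of_restrictsTo
    restrictsTo_squareReindex)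

namespace Summit.MatrixMultiplication.MatrixMultiplication.Cruxes.NAARCLadder.Det3FlatBirth

/-- The route's inline Levi-Civita tensor `ε₃` (`ε(a, a+1, a+2) = 1`, `ε(a, a+2, a+1) = -1`). -/
def eps : Fin 3 → Fin 3 → Fin 3 → ℂ :=
  fun a b c => (if b = a + 1 ∧ c = a + 2 then (1 : ℂ) else 0) - (if b = a + 2 ∧ c = a + 1 then 1 else 0)

/-- STUB (lower frame, provable now, size M⁻): `3 ≤ R̃(ε₃)` — `ε₃` is concise, its flattening
`ℂ³ → ℂ³ ⊗ ℂ³` has rank `3`, and the flattening rank bounds the asymptotic rank below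
(`flatteningRank_le_asymptoticRank`); alternatively `R̃(ε₃) < 3` would give `ω < 2` through the
in-tree skew-CW laser bound, contradicting `omega_two_le`. -/
theorem stub_lowerFrame : (3 : ℝ) ≤ asymptoticRank eps := by
  sorry

/-- STUB (the constructive content, OPEN, size XL): BORDER-RANK POWER DECAY for the Levi-Civita
tensor — for every `δ > 0` some Kronecker power has algebraic border rank `≤ (3 + δ)^N`
(`bR(ε₃^{⊠N})^{1/N} → 3`; record `17^{1/2} ≈ 4.12` at `N = 2`). Engine: border apolarity with the
Borel-fixed ideal theorem on `ε₃^{⊠N}` (Buczyńska–Buczyński 2021; Conner–Harper–Landsberg 2019 give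
the `N = 2` census), explicit `ℂ[ε]`-schemes certified by computer for `N = 3` (format `27`). -/
theorem stub_borderPowerDecay :
    ∀ δ : ℝ, 0 < δ → ∃ N : ℕ, 1 ≤ N ∧
      (algBorderRank (kroneckerPow eps N) : ℝ) ≤ (3 + δ) ^ N := by
  sorry

/-- TRANSFER (proved): border-rank power decay at rate `ρ` forces `R̃(t) ≤ ρ`, since
`R̃(t)^N ≤ R̃(t^{⊠N}) ≤ bR(t^{⊠N}) ≤ (ρ + δ)^N` for the good `N`, so `R̃(t) ≤ ρ + δ` for every
`δ > 0`. [folklore] -/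
theorem asymptoticRank_le_of_borderPowerDecay {ι κ μ : Type} [Fintype ι] [Fintype κ] [Fintype μ]
    [DecidableEq ι] [DecidableEq κ] [DecidableEq μ] (t : ι → κ → μ → ℂ) {ρ : ℝ} (hρ : 0 ≤ ρ)
    (h : ∀ δ : ℝ, 0 < δ → ∃ N : ℕ, 1 ≤ N ∧
      (algBorderRank (kroneckerPow t N) : ℝ) ≤ (ρ + δ) ^ N) :
    asymptoticRank t ≤ ρ := by
  refine le_of_forall_pos_le_add fun δ hδ => ?_
  obtain ⟨N, hN, hb⟩ := h δ hδ
  have h0 : 0 ≤ asymptoticRank t := asymptoticRank_nonneg t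
  have hpow : asymptoticRank t ^ N ≤ (ρ + δ) ^ N :=
    calc asymptoticRank t ^ N ≤ asymptoticRank (kroneckerPow t N) :=
          pow_asymptoticRank_le_asymptoticRank_kroneckerPow t hN
      _ ≤ algBorderRank (kroneckerPow t N) := asymptoticRank_le_algBorderRank _
      _ ≤ (ρ + δ) ^ N := hb
  exact (pow_le_pow_iff_left₀ h0 (by linarith) (by omega)).1 hpow

/-- SQUARING (proved): `R̃(t ⊠ t) = R̃(t)²` on `ℂ³ ⊗ ℂ³ ⊗ ℂ³` — `t ⊠ t` is the reindexed tensor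
power `t^{⊗2}` (restriction both ways) and `R̃(t^{⊗2}) = R̃(t)²`. [folklore] -/
theorem asymptoticRank_kroneckerTensor_self (t : Fin 3 → Fin 3 → Fin 3 → ℂ) :
    asymptoticRank (kroneckerTensor t t) = asymptoticRank t ^ 2 := by
  have e : squareReindex (kroneckerPow t 2) = kroneckerTensor t t := by
    funext a b c
    rw [squareReindex_kroneckerPow_two, kroneckerTensor_apply]
  have h1 : asymptoticRank (kroneckerTensor t t) = asymptoticRank (kroneckerPow t 2) := by
    rw [← e]
    exact asymptoticRank_eq_of_restrictsTo (restrictsTo_squareReindex _).1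
      (restrictsTo_squareReindex _).2
  rw [h1]
  exact le_antisymm (asymptoticRank_kroneckerPow_le _ (by norm_num))
    (pow_asymptoticRank_le_asymptoticRank_kroneckerPow _ (by norm_num))

/-- THE LINE (kernel-checked composition of the two REGISTERED stubs, by name): the route decl
`Det3Flat` (item `stmt-MatrixMultiplication-0591`) — `R̃(ε₃) = 3` from the stubs, then square. -/
theorem Det3Flat_proof : Summit.MatrixMultiplication.MatrixMultiplication.Theses.NonabelianARC.Det3Flat := by
  have h3 : asymptoticRank eps = 3 :=
    le_antisymm (asymptoticRank_le_of_borderPowerDecay _ (by norm_num) stub_borderPowerDecay)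
      stub_lowerFrame
  show asymptoticRank (kroneckerTensor eps eps) = 9
  rw [asymptoticRank_kroneckerTensor_self, h3]
  norm_num

/-- The same line read against the item's primary decl in route AsymptoticRankCW
(`BDet3AsymptoticRank`, verbatim the same statement, item `stmt-MatrixMultiplication-0591`). -/
theorem BDet3AsymptoticRank_proof :
    Summit.MatrixMultiplication.MatrixMultiplication.Theses.AsymptoticRankCW.BDet3AsymptoticRank :=
  Det3Flat_proof

/-- COMPOSITION with the stubs as explicit hypotheses (BC3 shape, no sorry): lower frame and
border power decay give the piece `Det3Flat`. -/
theorem Det3Flat_of :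
    ((3 : ℝ) ≤ asymptoticRank eps) →
    (∀ δ : ℝ, 0 < δ → ∃ N : ℕ, 1 ≤ N ∧
      (algBorderRank (kroneckerPow eps N) : ℝ) ≤ (3 + δ) ^ N) →
    Summit.MatrixMultiplication.MatrixMultiplication.Theses.NonabelianARC.Det3Flat := by
  intro hlow hdecay
  have h3 : asymptoticRank eps = 3 :=
    le_antisymm (asymptoticRank_le_of_borderPowerDecay _ (by norm_num) hdecay) hlow
  show asymptoticRank (kroneckerTensor eps eps) = 9
  rw [asymptoticRank_kroneckerTensor_self, h3]
  norm_num

end Summit.MatrixMultiplication.MatrixMultiplication.Cruxes.NAARCLadder.Det3FlatBirth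

end
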